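import Mathlib
import Summits.ABC.ABC.Statement

/-!
# Stub `stub_thueMahlerWindow` of line `Sketch` — crux `IneffectiveSubspace.DepthCountedABC` (stmt-ABC-14938)

WINDOW OF THE CELL-1 SUB-CRUX `UniformQuarticThueMahler η` (certificate, c22).  The sub-crux is the conjunction of
two uniform binomial quartic Thue–Mahler statements (`p` prime, all data positive, the two summands coprime):
bounded `Z` for the solutions of `a + p^k·u = v·Z⁴` with `a·u·v·p ≤ Z^η`, and bounded `Y` for the solutions of
`a + u·Y⁴ = p^w·v` with `a·u·v·p ≤ Y^η`.  This file pins its window: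

* (i) `ABC ⟹` both shapes for every `0 < η < 3`.  Mechanism: `(a, p^k u, v Z⁴)` resp. `(a, u Y⁴, p^w v)` is an
  abc triple with `rad ≤ a·(p u)·(v Z) = (a u v p)·Z ≤ Z^(1+η)` resp. `rad ≤ (a u v p)·Y ≤ Y^(1+η)` and
  `c ≥ Z⁴` resp. `c > u Y⁴ ≥ Y⁴`; with `ε := (3 − η)/8` one has `(1+η)(1+ε) = 4 − κ`, `κ = (3−η)(7−η)/8 > 0`,
  so `Z⁴ < C·Z^(4−κ)`, i.e. `Z < C^(1/κ)` (and the same bound for `Y`).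
* (ii) for every `η > 3` BOTH shapes are FALSE (sharp threshold `3`): with `x = 2^m` the identity
  `(4x³ + 6x² + 4x + 1) + 2^(4m)·1 = 1·(x+1)⁴` is an admissible configuration of the first shape (`Z = 2^m + 1` odd)
  with `a·u·v·p = 2a ≤ 30·Z³ ≤ Z^η` as soon as `Z^(η−3) ≥ 30`; and with `y = 2^m − 1` the identity
  `(4y³ + 6y² + 4y + 1) + 1·y⁴ = 2^(4m)·1` is one of the second shape (`Y = y` odd) with `2a ≤ 30·Y³ ≤ Y^η` as soon
  as `Y^(η−3) ≥ 30`.  Both families are unbounded, so no bound `B` exists.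

Sources: skeleton `Cruxes/DepthCountedABC/Lines/Sketch.lean` (lead c19/c22, stub `stub_thueMahlerWindow`); the abc
bookkeeping is adapted from the accepted sibling `…StubQuarticThueOfCellZero`.  Mathlib only
(`UniqueFactorizationMonoid.radical_mul_dvd`, `radical_pow`, `Nat.radical_le_self_iff`, `Real.rpow_*`,
`Nat.lt_two_pow_self`, `Nat.lt_floor_add_one`, `Nat.le_ceil`).
-/

-- `Summit.<Summit>.<Problem>` is the mandated summit-side namespace (CONVENTIONS §2); for the
-- single-conjunct summit `ABC` the two coincide, so the duplicate `ABC.ABC` is deliberate.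
set_option linter.dupNamespace false

namespace Summit.ABC.ABC.Theorems.DepthCountedABC

open UniqueFactorizationMonoid (radical)
open Literature.NumberTheory.DiophantineGeometry (IsABCTriple rad rad_def)

/-- In an equation `a + b = c`, coprimality of `b` and `c` is coprimality of `a` and `b`. [folklore] -/
private theorem coprime_of_sum {a b c : ℕ} (hsum : a + b = c) (hcop : Nat.Coprime b c) :
    Nat.Coprime a b := by
  have h1 : Nat.Coprime b (a + b) := by rw [hsum]; exact hcop
  exact (Nat.coprime_add_self_right.mp h1).symm

/-- Sub-multiplicativity of the radical of a triple: `rad(abc) ≤ A·B·D` once `rad a ≤ A`, `rad b ≤ B`,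
`rad c ≤ D`. [folklore] -/
private theorem rad_le_mul3 {a b c A B D : ℕ} (ha : radical a ≤ A) (hb : radical b ≤ B)
    (hc : radical c ≤ D) : rad a b c ≤ A * B * D := by
  have h2 : radical (a * b * c) ≤ radical (a * b) * radical c :=
    Nat.le_of_dvd (by positivity) UniqueFactorizationMonoid.radical_mul_dvd
  have h3 : radical (a * b) ≤ radical a * radical b :=
    Nat.le_of_dvd (by positivity) UniqueFactorizationMonoid.radical_mul_dvd
  calc rad a b c = radical (a * b * c) := rad_def a b c
    _ ≤ radical a * radical b * radical c := h2.trans (Nat.mul_le_mul_right _ h3)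
    _ ≤ A * B * D := Nat.mul_le_mul (Nat.mul_le_mul ha hb) hc

/-- `rad(p^k · u) ≤ p · u` for a prime `p` and `u ≥ 1`. [folklore] -/
private theorem radical_prime_pow_mul_le {p k u : ℕ} (hp : p.Prime) (hu : 0 < u) :
    radical (p ^ k * u) ≤ p * u := by
  have h1 : radical (p ^ k * u) ∣ radical (p ^ k) * radical u :=
    UniqueFactorizationMonoid.radical_mul_dvd
  have h2 : radical (p ^ k) ≤ p := by
    rcases Nat.eq_zero_or_pos k with rfl | hk
    · rw [pow_zero, UniqueFactorizationMonoid.radical_one]; exact hp.one_lt.le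
    · rw [UniqueFactorizationMonoid.radical_pow p hk.ne']
      exact Nat.radical_le_self_iff.mpr hp.ne_zero
  calc radical (p ^ k * u) ≤ radical (p ^ k) * radical u := Nat.le_of_dvd (by positivity) h1
    _ ≤ p * u := Nat.mul_le_mul h2 (Nat.radical_le_self_iff.mpr hu.ne')

/-- `rad(v · Z⁴) ≤ v · Z` for `v, Z ≥ 1`. [folklore] -/
private theorem radical_mul_pow_four_le {v Z : ℕ} (hv : 0 < v) (hZ : 0 < Z) :
    radical (v * Z ^ 4) ≤ v * Z := by
  have h1 : radical (v * Z ^ 4) ∣ radical v * radical (Z ^ 4) :=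
    UniqueFactorizationMonoid.radical_mul_dvd
  rw [UniqueFactorizationMonoid.radical_pow Z (by norm_num : (4 : ℕ) ≠ 0)] at h1
  calc radical (v * Z ^ 4) ≤ radical v * radical Z := Nat.le_of_dvd (by positivity) h1
    _ ≤ v * Z := Nat.mul_le_mul (Nat.radical_le_self_iff.mpr hv.ne') (Nat.radical_le_self_iff.mpr hZ.ne')

/-- The abc bookkeeping common to both shapes: if abc holds at exponent `1 + ε` with constant `C`, and an abc
triple `(a, b, c)` has `rad ≤ M·X`, `M ≤ X^η`, `X⁴ ≤ c` with `(1+η)(1+ε) ≤ 4 − κ`, `κ > 0`, then `X⁴ < C·X^(4−κ)`,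
so `X < C^(1/κ)` and `X ≤ ⌊C^(1/κ)⌋₊`. [folklore reduction] -/
private theorem bound_of_abc {C ε η κ : ℝ} (hCpos : 0 < C) (hε : 0 ≤ 1 + ε) (hκ : 0 < κ)
    (hexp : (1 + η) * (1 + ε) ≤ 4 - κ)
    (hC : ∀ a b c : ℕ, IsABCTriple a b c → (c : ℝ) < C * ((rad a b c : ℕ) : ℝ) ^ (1 + ε))
    {a b c M X : ℕ} (habc : IsABCTriple a b c) (hX : 0 < X) (hR : rad a b c ≤ M * X)
    (hM : (M : ℝ) ≤ (X : ℝ) ^ η) (hcX : X ^ 4 ≤ c) : X ≤ ⌊C ^ (1 / κ)⌋₊ := by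
  have hX1 : (1 : ℝ) ≤ (X : ℝ) := by exact_mod_cast hX
  have hX0 : (0 : ℝ) < (X : ℝ) := by linarith
  -- `rad ≤ X^(1+η)`
  have hRreal : ((rad a b c : ℕ) : ℝ) ≤ (X : ℝ) ^ (1 + η) := by
    have h1 : ((rad a b c : ℕ) : ℝ) ≤ (M : ℝ) * X := by exact_mod_cast hR
    have h2 : (M : ℝ) * X ≤ (X : ℝ) ^ η * X := mul_le_mul_of_nonneg_right hM hX0.le
    have h3 : (X : ℝ) ^ η * X = (X : ℝ) ^ (1 + η) := by
      rw [Real.rpow_add hX0, Real.rpow_one]; ring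
    linarith [h1, h2, h3.le]
  -- `X⁴ ≤ c < C·rad^(1+ε) ≤ C·X^(4−κ)`
  have hRpow : ((rad a b c : ℕ) : ℝ) ^ (1 + ε) ≤ (X : ℝ) ^ (4 - κ) :=
    calc ((rad a b c : ℕ) : ℝ) ^ (1 + ε) ≤ ((X : ℝ) ^ (1 + η)) ^ (1 + ε) :=
          Real.rpow_le_rpow (by positivity) hRreal hε
      _ = (X : ℝ) ^ ((1 + η) * (1 + ε)) := by rw [← Real.rpow_mul hX0.le]
      _ ≤ (X : ℝ) ^ (4 - κ) := Real.rpow_le_rpow_of_exponent_le hX1 hexp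
  have hcX' : (X : ℝ) ^ (4 : ℕ) ≤ (c : ℝ) := by exact_mod_cast hcX
  have hX4lt : (X : ℝ) ^ (4 : ℕ) < C * (X : ℝ) ^ (4 - κ) :=
    calc (X : ℝ) ^ (4 : ℕ) ≤ (c : ℝ) := hcX'
      _ < C * ((rad a b c : ℕ) : ℝ) ^ (1 + ε) := hC a b c habc
      _ ≤ C * (X : ℝ) ^ (4 - κ) := mul_le_mul_of_nonneg_left hRpow hCpos.le
  have hsplit : (X : ℝ) ^ (4 : ℕ) = (X : ℝ) ^ κ * (X : ℝ) ^ (4 - κ) := by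
    rw [← Real.rpow_add hX0, ← Real.rpow_natCast (X : ℝ) 4]; congr 1; push_cast; ring
  have hXκ : (X : ℝ) ^ κ < C := by
    rw [hsplit] at hX4lt
    exact lt_of_mul_lt_mul_right hX4lt (Real.rpow_nonneg hX0.le _)
  -- `X < C^(1/κ)`, hence `X ≤ ⌊C^(1/κ)⌋₊`
  have hXlt : (X : ℝ) < C ^ (1 / κ) := by
    have h1 : ((X : ℝ) ^ κ) ^ (1 / κ) < C ^ (1 / κ) :=
      Real.rpow_lt_rpow (Real.rpow_nonneg hX0.le _) hXκ (by positivity)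
    have h2 : ((X : ℝ) ^ κ) ^ (1 / κ) = (X : ℝ) := by
      rw [← Real.rpow_mul hX0.le, mul_one_div_cancel hκ.ne', Real.rpow_one]
    rw [h2] at h1; exact h1
  have h1 : (X : ℝ) < (⌊C ^ (1 / κ)⌋₊ : ℕ) + 1 := hXlt.trans (Nat.lt_floor_add_one _)
  have h2 : X < ⌊C ^ (1 / κ)⌋₊ + 1 := by exact_mod_cast h1
  omega

/-- Size bookkeeping for the counterexample families: `L ≤ X^(η−3)` (in `ℝ`) and `n ≤ L·X³` (in `ℕ`) give
`n ≤ X^η`. [folklore] -/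
private theorem cast_le_rpow_of_le_mul_cube {η : ℝ} {L n X : ℕ} (hX : 0 < X)
    (hL : (L : ℝ) ≤ (X : ℝ) ^ (η - 3)) (hn : n ≤ L * X ^ 3) : (n : ℝ) ≤ (X : ℝ) ^ η := by
  have hX0 : (0 : ℝ) < (X : ℝ) := by exact_mod_cast hX
  have h1 : (n : ℝ) ≤ (L : ℝ) * (X : ℝ) ^ (3 : ℕ) := by exact_mod_cast hn
  calc (n : ℝ) ≤ (L : ℝ) * (X : ℝ) ^ (3 : ℕ) := h1
    _ ≤ (X : ℝ) ^ (η - 3) * (X : ℝ) ^ (3 : ℕ) := mul_le_mul_of_nonneg_right hL (by positivity)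
    _ = (X : ℝ) ^ η := by
        rw [← Real.rpow_natCast (X : ℝ) 3, ← Real.rpow_add hX0]; congr 1; push_cast; ring

/-- The unbounded families: for `s > 0` and any `L N : ℕ` there is `m ≥ 1` such that `y := 2^m − 1` satisfies
`N ≤ y` and `L ≤ y^s`. [folklore] -/
private theorem exists_two_pow_sub_one {s : ℝ} (hs : 0 < s) (L N : ℕ) :
    ∃ m y : ℕ, 1 ≤ m ∧ y + 1 = 2 ^ m ∧ N ≤ y ∧ (L : ℝ) ≤ (y : ℝ) ^ s := by
  set T : ℝ := (L : ℝ) ^ (1 / s) with hT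
  have hT0 : 0 ≤ T := Real.rpow_nonneg (Nat.cast_nonneg L) _
  set m : ℕ := N + ⌈T⌉₊ + 1 with hm
  have hlt : m < 2 ^ m := Nat.lt_two_pow_self
  obtain ⟨y, hy⟩ : ∃ y : ℕ, 2 ^ m = y + 1 := ⟨2 ^ m - 1, by omega⟩
  refine ⟨m, y, by omega, hy.symm, by omega, ?_⟩
  have hTy : T ≤ (y : ℝ) := by
    have h1 : (⌈T⌉₊ : ℝ) ≤ (y : ℝ) := by exact_mod_cast (show ⌈T⌉₊ ≤ y by omega)
    exact (Nat.le_ceil T).trans h1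
  calc (L : ℝ) = T ^ s := by
        rw [hT, ← Real.rpow_mul (Nat.cast_nonneg L), one_div_mul_cancel hs.ne', Real.rpow_one]
    _ ≤ (y : ℝ) ^ s := Real.rpow_le_rpow hT0 hTy hs.le

/-- **Stub `stub_thueMahlerWindow` (window of `UniformQuarticThueMahler`, certificate c22) of line `Sketch`, crux
`DepthCountedABC` (stmt-ABC-14938):** (i) `ABC` implies, for every `0 < η < 3`, bounded `Z` for the positive
coprime solutions of `a + p^k·u = v·Z⁴` with `a·u·v·p ≤ Z^η` and bounded `Y` for those of `a + u·Y⁴ = p^w·v` with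
`a·u·v·p ≤ Y^η` (`p` prime); (ii) for every `η > 3` both boundedness statements are false — the threshold `3` is
sharp (`(2^m+1)⁴ − 2^(4m)` resp. `2^(4m) − (2^m−1)⁴` are `≤ 15·2^(3m)`). [folklore reduction] -/
theorem stub_thueMahlerWindow :
    (_root_.ABC → ∀ η : ℝ, 0 < η → η < 3 →
      (∃ B : ℕ, ∀ a u v p k Z : ℕ, p.Prime → 0 < a → 0 < u → 0 < v → 0 < Z →
        a + p ^ k * u = v * Z ^ 4 → Nat.Coprime (p ^ k * u) (v * Z ^ 4) →
        ((a * u * v * p : ℕ) : ℝ) ≤ (Z : ℝ) ^ η → Z ≤ B) ∧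
      (∃ B : ℕ, ∀ a u v p w Y : ℕ, p.Prime → 0 < a → 0 < u → 0 < v → 0 < Y →
        a + u * Y ^ 4 = p ^ w * v → Nat.Coprime (u * Y ^ 4) (p ^ w * v) →
        ((a * u * v * p : ℕ) : ℝ) ≤ (Y : ℝ) ^ η → Y ≤ B)) ∧
    (∀ η : ℝ, 3 < η →
      (¬ ∃ B : ℕ, ∀ a u v p k Z : ℕ, p.Prime → 0 < a → 0 < u → 0 < v → 0 < Z →
        a + p ^ k * u = v * Z ^ 4 → Nat.Coprime (p ^ k * u) (v * Z ^ 4) →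
        ((a * u * v * p : ℕ) : ℝ) ≤ (Z : ℝ) ^ η → Z ≤ B) ∧
      (¬ ∃ B : ℕ, ∀ a u v p w Y : ℕ, p.Prime → 0 < a → 0 < u → 0 < v → 0 < Y →
        a + u * Y ^ 4 = p ^ w * v → Nat.Coprime (u * Y ^ 4) (p ^ w * v) →
        ((a * u * v * p : ℕ) : ℝ) ≤ (Y : ℝ) ^ η → Y ≤ B)) := by
  refine ⟨fun habc η hη hη3 => ?_, fun η hη => ⟨?_, ?_⟩⟩
  · -- (i) abc at `ε = (3 − η)/8` bounds both shapes
    obtain ⟨C, hCpos, hC⟩ := ABC_iff.mp habc ((3 - η) / 8) (div_pos (by linarith) (by norm_num))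
    have hε : (0 : ℝ) ≤ 1 + (3 - η) / 8 := by linarith
    have hκpos : 0 < (3 - η) * (7 - η) / 8 :=
      div_pos (mul_pos (by linarith) (by linarith)) (by norm_num)
    have hexp : (1 + η) * (1 + (3 - η) / 8) ≤ 4 - (3 - η) * (7 - η) / 8 := le_of_eq (by ring)
    refine ⟨⟨⌊C ^ (1 / ((3 - η) * (7 - η) / 8))⌋₊, ?_⟩, ⟨⌊C ^ (1 / ((3 - η) * (7 - η) / 8))⌋₊, ?_⟩⟩
    · -- first shape: the abc triple `(a, p^k u, v Z⁴)`
      intro a u v p k Z hp ha hu hv hZ hsum hcop hsize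
      have hp0 : 0 < p := hp.pos
      have habc' : IsABCTriple a (p ^ k * u) (v * Z ^ 4) :=
        ⟨ha, by positivity, hsum, coprime_of_sum hsum hcop⟩
      have hR : rad a (p ^ k * u) (v * Z ^ 4) ≤ a * u * v * p * Z :=
        calc rad a (p ^ k * u) (v * Z ^ 4) ≤ a * (p * u) * (v * Z) :=
              rad_le_mul3 (Nat.radical_le_self_iff.mpr ha.ne') (radical_prime_pow_mul_le hp hu)
                (radical_mul_pow_four_le hv hZ)
          _ = a * u * v * p * Z := by ring
      exact bound_of_abc hCpos hε hκpos hexp hC habc' hZ hR hsize (Nat.le_mul_of_pos_left _ hv)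
    · -- second shape: the abc triple `(a, u Y⁴, p^w v)`
      intro a u v p w Y hp ha hu hv hY hsum hcop hsize
      have hp0 : 0 < p := hp.pos
      have habc' : IsABCTriple a (u * Y ^ 4) (p ^ w * v) :=
        ⟨ha, by positivity, hsum, coprime_of_sum hsum hcop⟩
      have hR : rad a (u * Y ^ 4) (p ^ w * v) ≤ a * u * v * p * Y :=
        calc rad a (u * Y ^ 4) (p ^ w * v) ≤ a * (u * Y) * (p * v) :=
              rad_le_mul3 (Nat.radical_le_self_iff.mpr ha.ne') (radical_mul_pow_four_le hu hY)
                (radical_prime_pow_mul_le hp hv)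
          _ = a * u * v * p * Y := by ring
      have hcY : Y ^ 4 ≤ p ^ w * v :=
        calc Y ^ 4 ≤ u * Y ^ 4 := Nat.le_mul_of_pos_left _ hu
          _ ≤ a + u * Y ^ 4 := Nat.le_add_left _ _
          _ = p ^ w * v := hsum
      exact bound_of_abc hCpos hε hκpos hexp hC habc' hY hR hsize hcY
  · -- (ii), first shape: `(4x³+6x²+4x+1) + 2^(4m)·1 = 1·(x+1)⁴`, `x = 2^m = y + 1`, `Z = y + 2`
    rintro ⟨B, hB⟩
    have hs : 0 < η - 3 := by linarith
    obtain ⟨m, y, hm, hy, hBy, h30⟩ := exists_two_pow_sub_one hs 30 (B + 1)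
    have h2y : 2 ∣ y + 1 := by rw [hy]; exact dvd_pow_self 2 (by omega)
    have hcopZ : Nat.Coprime 2 (y + 2) := by
      rw [Nat.Prime.coprime_iff_not_dvd Nat.prime_two]; omega
    have hsum : 4 * (y + 1) ^ 3 + 6 * (y + 1) ^ 2 + 4 * (y + 1) + 1 + 2 ^ (4 * m) * 1 =
        1 * (y + 2) ^ 4 := by
      rw [pow_mul', ← hy]; ring
    have hcop : Nat.Coprime (2 ^ (4 * m) * 1) (1 * (y + 2) ^ 4) := by
      rw [mul_one, one_mul]; exact Nat.Coprime.pow _ _ hcopZ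
    have h2a : (4 * (y + 1) ^ 3 + 6 * (y + 1) ^ 2 + 4 * (y + 1) + 1) * 1 * 1 * 2 ≤ 30 * (y + 2) ^ 3 :=
      Nat.le.intro (k := 22 * y ^ 3 + 144 * y ^ 2 + 304 * y + 210) (by ring)
    have h30' : ((30 : ℕ) : ℝ) ≤ ((y + 2 : ℕ) : ℝ) ^ (η - 3) :=
      h30.trans (Real.rpow_le_rpow (by positivity) (by push_cast; linarith) hs.le)
    have hsize := cast_le_rpow_of_le_mul_cube (by omega : 0 < y + 2) h30' h2a
    have := hB _ 1 1 2 (4 * m) (y + 2) Nat.prime_two (Nat.succ_pos _) one_pos one_pos (by omega)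
      hsum hcop hsize
    omega
  · -- (ii), second shape: `(4y³+6y²+4y+1) + 1·y⁴ = 2^(4m)·1`, `y = 2^m − 1 = Y`
    rintro ⟨B, hB⟩
    have hs : 0 < η - 3 := by linarith
    obtain ⟨m, y, hm, hy, hBy, h30⟩ := exists_two_pow_sub_one hs 30 (B + 1)
    have h2y : 2 ∣ y + 1 := by rw [hy]; exact dvd_pow_self 2 (by omega)
    have hcopY : Nat.Coprime y 2 := by
      rw [Nat.coprime_comm, Nat.Prime.coprime_iff_not_dvd Nat.prime_two]; omega
    have hsum : 4 * y ^ 3 + 6 * y ^ 2 + 4 * y + 1 + 1 * y ^ 4 = 2 ^ (4 * m) * 1 := by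
      rw [pow_mul', ← hy]; ring
    have hcop : Nat.Coprime (1 * y ^ 4) (2 ^ (4 * m) * 1) := by
      rw [mul_one, one_mul]; exact Nat.Coprime.pow _ _ hcopY
    have h2a : (4 * y ^ 3 + 6 * y ^ 2 + 4 * y + 1) * 1 * 1 * 2 ≤ 30 * y ^ 3 := by
      obtain ⟨z, rfl⟩ : ∃ z, y = z + 1 := ⟨y - 1, by omega⟩
      exact Nat.le.intro (k := 22 * z ^ 3 + 54 * z ^ 2 + 34 * z) (by ring)
    have hsize := cast_le_rpow_of_le_mul_cube (by omega : 0 < y) h30 h2a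
    have := hB _ 1 1 2 (4 * m) y Nat.prime_two (Nat.succ_pos _) one_pos one_pos (by omega)
      hsum hcop hsize
    omega

end Summit.ABC.ABC.Theorems.DepthCountedABC
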